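import Literature.Probability.RandomPlanarGeometry.SLEMarkovKernel
import HarnessLib

/-!
# The domain-Markov kernel of chordal SLE_κ: boundary behaviour of the parametrisation

Topic `Probability/RandomPlanarGeometry`; theorems only (companion of `SLEMarkovKernel.lean`,
crux `stmt-CriticalPhenomena-0698`, stub `stub_isDomainMarkov`).

* `SLEConfig.exists_forall_norm_bdryInv_sub_le` — `f̄_r` moves points of the closed half-plane by
  a bounded amount (`Loewner.exists_forall_norm_map_sub_self_le`, extended by continuity);
* `SLEConfig.tendsto_ψ_cocompact` — the parametrisation `ψ = Φ ∘ f̄_r(· + W r)` of an explored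
  configuration tends to the target `b` at infinity within the closed half-plane;
* the boundary values of the conformal equivalence `SLEConfig.conf : ℍₒ → dom`: the tip at `0`
  (`hasBoundaryValue_conf_zero`), the target at `∞` (`hasBoundaryValueAtInfty_conf`), the value
  `ψ x` at every real `x`, and the target at NO finite real point
  (`not_hasBoundaryValue_conf_tgt`, boundary correspondence); `tip_ne_tgt`.

References: G. F. Lawler, *Conformally Invariant Processes in the Plane* (2005), §4.1, §6.2;
Ch. Pommerenke, *Boundary Behaviour of Conformal Maps* (1992), Thm. 2.6.
-/

noncomputable section

open Set Filter Topology MeasureTheory ProbabilityTheory Complex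
open UpperHalfPlane (upperHalfPlaneSet isOpen_upperHalfPlaneSet)
open scoped NNReal ENNReal unitInterval


namespace Literature.Probability.RandomPlanarGeometry

/-! ### Boundary behaviour of the parametrisation of a configuration -/

namespace SLEConfig

variable (c : SLEConfig)

/-- `f̄_r` moves points of the closed half-plane by a bounded amount: there is `C₀` with
`‖f̄_r z - z‖ ≤ C₀` whenever `0 ≤ im z` (`‖g_r z - z‖ ≤ C₀` on `H_r`, extended by continuity).
[cite: Lawler2005, §4.1] -/
theorem exists_forall_norm_bdryInv_sub_le :
    ∃ C₀ : ℝ, ∀ z : ℂ, 0 ≤ z.im → ‖Loewner.bdryInv c.W c.r z - z‖ ≤ C₀ := by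
  obtain ⟨C₀, -, hC₀⟩ := Loewner.exists_forall_norm_map_sub_self_le c.contW c.r
  refine ⟨C₀, fun z hz ↦ ?_⟩
  -- on `ℍₒ`: `f_r z = w` with `g_r w = z`
  have hH : ∀ z ∈ upperHalfPlaneSet, ‖Loewner.loewnerInv c.W c.r z - z‖ ≤ C₀ := by
    intro z hz
    have hw := Loewner.loewnerInv_mem_domain c.contW c.r hz
    have h := hC₀ _ hw
    rwa [Loewner.map_loewnerInv c.contW c.r hz, norm_sub_rev] at h
  -- pass to the limit within `ℍₒ`
  have hcl : z ∈ closure upperHalfPlaneSet := mem_closure_upperHalfPlaneSet_iff.2 hz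
  haveI : (𝓝[upperHalfPlaneSet] z).NeBot := mem_closure_iff_nhdsWithin_neBot.1 hcl
  have ht : Tendsto (fun w ↦ Loewner.loewnerInv c.W c.r w - w) (𝓝[upperHalfPlaneSet] z)
      (𝓝 (Loewner.bdryInv c.W c.r z - z)) :=
    (c.isGeneratedByCurve.tendsto_bdryInv c.contW c.r hz).sub
      (tendsto_nhdsWithin_of_tendsto_nhds tendsto_id)
  exact le_of_tendsto ((continuous_norm.tendsto _).comp ht)
    (eventually_nhdsWithin_of_forall fun w hw ↦ hH w hw)

/-- **`ψ w → b` as `w → ∞` in the closed half-plane.** [cite: Lawler2005, §6.2] -/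
theorem tendsto_ψ_cocompact :
    Tendsto c.ψ (cocompact ℂ ⊓ 𝓟 (closure upperHalfPlaneSet)) (𝓝 c.tgt) := by
  rw [ConformalEquiv.closure_upperHalfPlaneSet_eq]
  obtain ⟨C₀, hC₀⟩ := c.exists_forall_norm_bdryInv_sub_le
  -- the inner map tends to infinity within the closed half-plane
  set g : ℂ → ℂ := fun w ↦ Loewner.bdryInv c.W c.r (projH w + c.W c.r) with hg
  have hgt : Tendsto g (cocompact ℂ ⊓ 𝓟 {z : ℂ | 0 ≤ z.im})
      (cocompact ℂ ⊓ 𝓟 {z : ℂ | 0 ≤ z.im}) := by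
    refine tendsto_inf.2 ⟨?_, tendsto_principal.2 ?_⟩
    · -- `‖g w‖ ≥ ‖w‖ - |W r| - C₀` on the closed half-plane
      rw [tendsto_def]
      intro S hS
      rw [mem_cocompact] at hS
      obtain ⟨K, hK, hKS⟩ := hS
      obtain ⟨R, hR⟩ := hK.isBounded.subset_closedBall 0
      rw [mem_inf_principal, mem_cocompact]
      refine ⟨Metric.closedBall 0 (R + |c.W c.r| + C₀), isCompact_closedBall 0 _, fun w hw hw0 ↦ ?_⟩
      apply hKS
      intro hgK
      have h1 : ‖g w‖ ≤ R := by simpa using hR hgK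
      have h2 : ‖g w - (projH w + c.W c.r)‖ ≤ C₀ := hC₀ _ (c.projH_add_im_nonneg w)
      have h3 : projH w = w := projH_of_im_nonneg hw0
      rw [h3] at h2
      have h4 : ‖w‖ ≤ ‖g w‖ + ‖g w - (w + c.W c.r)‖ + ‖(c.W c.r : ℂ)‖ := by
        have := norm_sub_le (g w) (g w - (w + c.W c.r))
        have e : g w - (g w - (w + c.W c.r)) = w + c.W c.r := by ring
        rw [e] at this
        have := norm_add_le (w + c.W c.r) (-(c.W c.r : ℂ))
        have e2 : w + c.W c.r + -(c.W c.r : ℂ) = w := by ring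
        rw [e2, norm_neg] at this
        linarith [norm_add_le (g w) (-(g w - (w + ↑(c.W c.r))))]
      have h5 : ‖(c.W c.r : ℂ)‖ = |c.W c.r| := by simp
      apply hw
      rw [Metric.mem_closedBall, dist_zero_right]
      linarith
    · filter_upwards [mem_inf_of_right (mem_principal_self _)] with w hw
      exact c.bdryInv_im_nonneg (c.projH_add_im_nonneg w)
  exact c.tendsto_Φ_cocompact.comp hgt

/-- `conf` has a boundary value at every point of the closed half-plane, namely `ψ` there
(`ψ` is continuous on `ℂ`). [folklore] -/
theorem hasBoundaryValue_conf (x : ℂ) : c.conf.HasBoundaryValue x (c.ψ x) :=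
  (c.continuous_ψ.tendsto x).mono_left nhdsWithin_le_nhds

/-- Boundary values of `conf` are values of `ψ`. [folklore] -/
theorem hasBoundaryValue_conf_iff {x : ℂ} (hx : 0 ≤ x.im) {p : ℂ} :
    c.conf.HasBoundaryValue x p ↔ c.ψ x = p := by
  haveI : (𝓝[upperHalfPlaneSet] x).NeBot :=
    mem_closure_iff_nhdsWithin_neBot.1 (mem_closure_upperHalfPlaneSet_iff.2 hx)
  exact ⟨fun h ↦ tendsto_nhds_unique (c.hasBoundaryValue_conf x) h, fun h ↦ h ▸ c.hasBoundaryValue_conf x⟩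

/-- **`conf` has boundary value the tip at `0`.** [cite: Lawler2005, Prop. 4.31] -/
theorem hasBoundaryValue_conf_zero : c.conf.HasBoundaryValue 0 c.tip :=
  c.ψ_zero ▸ c.hasBoundaryValue_conf 0

/-- **`conf` has boundary value the target at infinity.** [folklore] -/
theorem hasBoundaryValueAtInfty_conf : c.conf.HasBoundaryValueAtInfty c.tgt :=
  c.tendsto_ψ_cocompact.mono_left (inf_le_inf_left _ (principal_mono.2 subset_closure))

/-- **The target is not a boundary value of `conf` at a finite real point.** [folklore] -/
theorem not_hasBoundaryValue_conf_tgt (x : ℝ) : ¬ c.conf.HasBoundaryValue x c.tgt := by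
  rw [c.hasBoundaryValue_conf_iff (by simp)]
  exact c.ψ_ne_tgt (by simp)

/-- The tip is not the target. [folklore] -/
theorem tip_ne_tgt : c.tip ≠ c.tgt := by
  rw [← c.ψ_zero]
  exact c.ψ_ne_tgt le_rfl

end SLEConfig

end Literature.Probability.RandomPlanarGeometry

end
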